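import Literature.Analysis.TotalPositivity.JacobiSturmWeighted
import Mathlib.Algebra.Order.Ring.Abs
import Mathlib.Algebra.Ring.Parity
import Mathlib.Tactic.Positivity
import Mathlib.Tactic.FieldSimp

/-!
# Route `AnisotropyChord`: exact lumping on `K_{m,m}`, step 4 — the FOLDED occupancy chain is a
# monotonically tilted birth–death chain, hence MLR (discrete Sturm comparison)

Abstract input (the output of `cb_classFun` for two anisotropies): functions `F, G : ℕ → ℝ` which
vanish below `aₗ = W − min(W, m)`, are positive on `[aₗ, ⌊W/2⌋]`, mirror-symmetric (`F(W−a) = F(a)`),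
and satisfy the lumped equations
`E F(a) = −Δ Z(a) F(a) − ½(a(m−W+a)F(a−1) + (m−a)(W−a)F(a+1))`, `Z(a) = (m/2 − a)(m/2 − (W−a))`,
with anisotropies `Δ' ≤ Δ` (for `G`: `Δ', E'`).

* `cb_halfChain_mlr` — **MLR on the lower half**: `F(b) G(b') ≤ F(b') G(b)` for `aₗ ≤ b ≤ b' ≤ ⌊W/2⌋`.
  Proof: fold the chain at `W/2` using the mirror symmetry (the reflected neighbour of the top site
  is the site itself for `W` odd, the site below for `W` even), index it by `k = a − aₗ + 1`, and apply
  `Literature.Analysis.TotalPositivity.bd_mlr_pairs` with tilt `s = −Δ`, potential `V = Z(a)`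
  (non-decreasing on the lower half: `Z(a') − Z(a) = (a'−a)(W−a−a') ≥ 0`), couplings
  `lo = ½a(m−W+a)`, `up = ½(m−a)(W−a)` and detailed-balance weights defined by the balance recursion.

Theory seat `hubbard-h0-rotor-theory-1`, memo ROTOR-THEORY-6 §61 (i) ("folded occupancy chain
`u = min(a, W−a)`").  F. Gantmacher, M. Krein (2002) Ch. II.  No definition is introduced.
-/

set_option linter.dupNamespace false

noncomputable section

namespace Summit.HubbardSuperconductivity.HubbardSuperconductivity.Theorems.AnisotropyChord

open Finset
open Literature.Analysis.TotalPositivity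

/-- **MLR on the lower half of the occupancy chain of `K_{m,m}`** (see the module docstring).
[folklore] -/
theorem cb_halfChain_mlr (m W : ℕ) (hWm : W ≤ 2 * m) {F G : ℕ → ℝ} {Δ Δ' E E' : ℝ}
    (hF0 : ∀ a, a + 1 = W - min W m → F a = 0) (hG0 : ∀ a, a + 1 = W - min W m → G a = 0)
    (hFpos : ∀ a, W - min W m ≤ a → a ≤ W / 2 → 0 < F a)
    (hGpos : ∀ a, W - min W m ≤ a → a ≤ W / 2 → 0 < G a)
    (hFmir : ∀ a, a ≤ W → F (W - a) = F a) (hGmir : ∀ a, a ≤ W → G (W - a) = G a)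
    (hFeq : ∀ a, W - min W m ≤ a → a ≤ W / 2 →
      E * F a = -(Δ * (((m : ℝ) / 2 - a) * ((m : ℝ) / 2 - ((W : ℝ) - a)))) * F a
        - (1 / 2) * ((a : ℝ) * ((m : ℝ) - ((W : ℝ) - a)) * F (a - 1) + ((m : ℝ) - a) * ((W : ℝ) - a) * F (a + 1)))
    (hGeq : ∀ a, W - min W m ≤ a → a ≤ W / 2 →
      E' * G a = -(Δ' * (((m : ℝ) / 2 - a) * ((m : ℝ) / 2 - ((W : ℝ) - a)))) * G a
        - (1 / 2) * ((a : ℝ) * ((m : ℝ) - ((W : ℝ) - a)) * G (a - 1) + ((m : ℝ) - a) * ((W : ℝ) - a) * G (a + 1)))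
    (hΔ : Δ' ≤ Δ) :
    ∀ b b', W - min W m ≤ b → b ≤ b' → b' ≤ W / 2 → F b * G b' ≤ F b' * G b := by
  -- the half chain `aₗ, …, u`, indexed by `k = a − aₗ + 1 ∈ [1, n]`
  set aₗ : ℕ := W - min W m with haₗ
  set u : ℕ := W / 2 with hu
  have haₗu : aₗ ≤ u := by simp only [haₗ, hu]; omega
  set n : ℕ := u - aₗ + 1 with hn
  have hn1 : 1 ≤ n := by omega
  -- chain functions
  set f : ℕ → ℝ := fun k => if k = 0 ∨ n < k then 0 else F (aₗ + (k - 1)) with hf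
  set g : ℕ → ℝ := fun k => if k = 0 ∨ n < k then 0 else G (aₗ + (k - 1)) with hg
  have hfk : ∀ k, 1 ≤ k → k ≤ n → f k = F (aₗ + (k - 1)) := fun k h1 h2 => by
    simp only [hf]; rw [if_neg (by omega)]
  have hgk : ∀ k, 1 ≤ k → k ≤ n → g k = G (aₗ + (k - 1)) := fun k h1 h2 => by
    simp only [hg]; rw [if_neg (by omega)]
  have hf0 : f 0 = 0 := by simp [hf]
  have hg0 : g 0 = 0 := by simp [hg]
  have hfn : f (n + 1) = 0 := by simp only [hf]; rw [if_pos (Or.inr (by omega))]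
  have hgn : g (n + 1) = 0 := by simp only [hg]; rw [if_pos (Or.inr (by omega))]
  -- couplings, potential, weights
  set up : ℕ → ℝ := fun k => (1 / 2) * (((m : ℝ) - (aₗ + (k - 1) : ℕ)) * ((W : ℝ) - (aₗ + (k - 1) : ℕ)))
    with hup
  set lo : ℕ → ℝ := fun k => if k = n then
      (1 / 2) * (((u : ℕ) : ℝ) * ((m : ℝ) - ((W : ℝ) - u))) +
        (if Even W then (1 / 2) * (((m : ℝ) - u) * ((W : ℝ) - u)) else 0)
    else (1 / 2) * (((aₗ + (k - 1) : ℕ) : ℝ) * ((m : ℝ) - ((W : ℝ) - (aₗ + (k - 1) : ℕ)))) with hlo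
  set bb : ℕ → ℝ := fun k => if k = n then
      (if Even W then 0 else (1 / 2) * (((m : ℝ) - u) * ((W : ℝ) - u))) else 0 with hbb
  set V : ℕ → ℝ := fun k => ((m : ℝ) / 2 - (aₗ + (k - 1) : ℕ)) * ((m : ℝ) / 2 - ((W : ℝ) - (aₗ + (k - 1) : ℕ)))
    with hV
  set π : ℕ → ℝ := fun k => ∏ i ∈ Finset.Ico 1 k, up i / lo (i + 1) with hπ
  -- positivity of the couplings
  have hup_pos : ∀ k, 1 ≤ k → k < n → 0 < up k := by
    intro k hk1 hkn
    simp only [hup]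
    have ha : aₗ + (k - 1) < u := by omega
    have h1 : ((aₗ + (k - 1) : ℕ) : ℝ) < m := by
      have : u ≤ m := by rw [hu]; omega
      exact_mod_cast lt_of_lt_of_le ha this
    have h2 : ((aₗ + (k - 1) : ℕ) : ℝ) < W := by
      have : u ≤ W := Nat.div_le_self W 2
      have : aₗ + (k - 1) < W := by omega
      exact_mod_cast this
    have := mul_pos (sub_pos.2 h1) (sub_pos.2 h2)
    positivity
  have hlo_pos : ∀ k, 2 ≤ k → k ≤ n → 0 < lo k := by
    intro k hk2 hkn
    have hgen : ∀ a : ℕ, aₗ + 1 ≤ a → 0 < (1 / 2) * ((a : ℝ) * ((m : ℝ) - ((W : ℝ) - a))) := by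
      intro a ha
      have h1 : (0 : ℝ) < a := by exact_mod_cast (show 0 < a by omega)
      have h2 : (0 : ℝ) < (m : ℝ) - ((W : ℝ) - a) := by
        have : W < m + a := by simp only [haₗ] at ha; omega
        have : (W : ℝ) < (m : ℝ) + a := by exact_mod_cast this
        linarith
      positivity
    simp only [hlo]
    by_cases hk : k = n
    · rw [if_pos hk]
      have h1 := hgen u (by omega)
      have h2 : 0 ≤ (if Even W then (1 / 2) * (((m : ℝ) - u) * ((W : ℝ) - u)) else 0) := by
        split_ifs
        · have hum : (u : ℝ) ≤ m := by exact_mod_cast (show u ≤ m by rw [hu]; omega)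
          have huW : (u : ℝ) ≤ W := by exact_mod_cast Nat.div_le_self W 2
          have := mul_nonneg (sub_nonneg.2 hum) (sub_nonneg.2 huW)
          positivity
        · exact le_rfl
      linarith
    · rw [if_neg hk]
      exact hgen _ (by omega)
  have hπ_succ : ∀ k, 1 ≤ k → π (k + 1) = π k * (up k / lo (k + 1)) := by
    intro k hk
    simp only [hπ]
    rw [Finset.prod_Ico_succ_top hk]
  have hπ_pos : ∀ k, 1 ≤ k → k ≤ n → 0 < π k := by
    intro k hk1 hkn
    induction k with
    | zero => omega
    | succ k ih =>
      rcases Nat.eq_zero_or_pos k with rfl | hkpos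
      · simp [hπ]
      · rw [hπ_succ k hkpos]
        exact mul_pos (ih hkpos (by omega)) (div_pos (hup_pos k hkpos (by omega)) (hlo_pos (k + 1) (by omega) hkn))
  have hbal : ∀ k, 1 ≤ k → k < n → π k * up k = π (k + 1) * lo (k + 1) := by
    intro k hk1 hkn
    rw [hπ_succ k hk1, mul_assoc, div_mul_cancel₀ _ (hlo_pos (k + 1) (by omega) (by omega)).ne']
  -- the potential is non-decreasing on the half chain
  have hVmono : ∀ i j, 1 ≤ i → i ≤ j → j ≤ n → V i ≤ V j := by
    intro i j hi hij hjn
    simp only [hV]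
    have hsum : ((aₗ + (i - 1) : ℕ) : ℝ) + ((aₗ + (j - 1) : ℕ) : ℝ) ≤ W := by
      have : aₗ + (i - 1) + (aₗ + (j - 1)) ≤ W := by
        have : aₗ + (j - 1) ≤ u := by omega
        have : 2 * u ≤ W := by rw [hu]; omega
        omega
      exact_mod_cast this
    have hle : ((aₗ + (i - 1) : ℕ) : ℝ) ≤ ((aₗ + (j - 1) : ℕ) : ℝ) := by exact_mod_cast (show aₗ + (i - 1) ≤ aₗ + (j - 1) by omega)
    nlinarith
  -- the chain equations
  have heqn : ∀ {H : ℕ → ℝ} {D EE : ℝ} {h : ℕ → ℝ},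
      (∀ a, a + 1 = aₗ → H a = 0) → (∀ a, a ≤ W → H (W - a) = H a) →
      (∀ a, aₗ ≤ a → a ≤ u →
        EE * H a = -(D * (((m : ℝ) / 2 - a) * ((m : ℝ) / 2 - ((W : ℝ) - a)))) * H a
          - (1 / 2) * ((a : ℝ) * ((m : ℝ) - ((W : ℝ) - a)) * H (a - 1) + ((m : ℝ) - a) * ((W : ℝ) - a) * H (a + 1))) →
      (∀ k, 1 ≤ k → k ≤ n → h k = H (aₗ + (k - 1))) → h 0 = 0 → h (n + 1) = 0 →
      ∀ k, 1 ≤ k → k ≤ n → lo k * h (k - 1) + bb k * h k + up k * h (k + 1) = ((-D) * V k - EE) * h k := by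
    intro H D EE h hH0 hHmir hHeq hhk hh0 hhn k hk1 hkn
    have ha : aₗ ≤ aₗ + (k - 1) := by omega
    have hau : aₗ + (k - 1) ≤ u := by omega
    have heq := hHeq (aₗ + (k - 1)) ha hau
    rw [hhk k hk1 hkn]
    -- the lower neighbour
    have hlow : ((aₗ + (k - 1) : ℕ) : ℝ) * ((m : ℝ) - ((W : ℝ) - (aₗ + (k - 1) : ℕ))) * H (aₗ + (k - 1) - 1) =
        ((aₗ + (k - 1) : ℕ) : ℝ) * ((m : ℝ) - ((W : ℝ) - (aₗ + (k - 1) : ℕ))) * h (k - 1) := by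
      rcases hk1.eq_or_lt with hk1' | hk2
      · -- k = 1: coefficient vanishes or H(aₗ - 1) = 0
        subst hk1'
        simp only [Nat.sub_self, add_zero, hh0, mul_zero]
        rcases Nat.eq_zero_or_pos aₗ with h0 | hpos
        · rw [h0]; simp
        · rw [hH0 (aₗ - 1) (by omega), mul_zero]
      · rw [hhk (k - 1) (by omega) (by omega)]
        congr 2
        omega
    simp only [hV]
    by_cases hk : k = n
    · -- the fold row
      subst hk
      have htop : aₗ + (n - 1) = u := by omega
      rw [htop] at heq hlow ⊢
      simp only [hlo, hbb, if_true, hhn, mul_zero, add_zero]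
      -- the reflected neighbour `H (u + 1)`
      rcases Nat.even_or_odd W with hev | hodd
      · simp only [if_pos hev]
        rcases Nat.eq_zero_or_pos W with hW0 | hWpos
        · -- W = 0: u = 0, the upper coefficient vanishes
          have hu0 : u = 0 := by rw [hu, hW0]
          rw [hu0] at heq hlow ⊢
          simp only [hW0, Nat.cast_zero, sub_zero, mul_zero, zero_mul] at heq ⊢
          have hal0 : aₗ = 0 := by omega
          -- h (n-1): n = 1
          have hn1' : n = 1 := by omega
          rw [hn1'] at *
          simp only [Nat.sub_self, hh0, mul_zero, add_zero] at heq ⊢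
          linarith
        · have hW2 : W = 2 * u := by obtain ⟨r, hr⟩ := hev; rw [hu]; omega
          have hrefl : H (u + 1) = H (u - 1) := by
            have := hHmir (u + 1) (by omega)
            rw [show W - (u + 1) = u - 1 by omega] at this
            exact this.symm
          rw [hrefl] at heq
          -- H (u - 1) = h (n - 1) (or both vanish)
          have hum1 : ((u : ℕ) : ℝ) * ((m : ℝ) - ((W : ℝ) - u)) * H (u - 1) +
              ((m : ℝ) - u) * ((W : ℝ) - u) * H (u - 1) =
              (((u : ℕ) : ℝ) * ((m : ℝ) - ((W : ℝ) - u)) + ((m : ℝ) - u) * ((W : ℝ) - u)) * h (n - 1) := by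
            rcases hn1.eq_or_lt with hn1' | hn2
            · -- n = 1 : u = aₗ, H (u - 1) = 0 unless u = 0
              rw [← hn1'] at hlow ⊢
              simp only [Nat.sub_self, hh0, mul_zero]
              rcases Nat.eq_zero_or_pos u with hu0 | hupos
              · exfalso; omega
              · have : H (u - 1) = 0 := hH0 (u - 1) (by omega)
                rw [this]; ring
            · rw [hhk (n - 1) (by omega) (by omega), show aₗ + (n - 1 - 1) = u - 1 by omega]
              ring
          linear_combination heq - (1 / 2) * hum1
      · simp only [if_neg (Nat.not_even_iff_odd.2 hodd)]
        have hW2 : W = 2 * u + 1 := by obtain ⟨r, hr⟩ := hodd; rw [hu]; omega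
        have hrefl : H (u + 1) = H u := by
          have := hHmir (u + 1) (by omega)
          rw [show W - (u + 1) = u by omega] at this
          exact this.symm
        rw [hrefl] at heq
        linear_combination heq - (1 / 2) * hlow
    · -- generic row
      have hkn' : k < n := lt_of_le_of_ne hkn hk
      simp only [hlo, hbb, if_neg hk, zero_mul, add_zero]
      rw [hhk (k + 1) (by omega) (by omega), show aₗ + (k + 1 - 1) = aₗ + (k - 1) + 1 by omega]
      linear_combination heq - (1 / 2) * hlow
  have hfeq := heqn hF0 hFmir hFeq hfk hf0 hfn
  have hgeq := heqn hG0 hGmir hGeq hgk hg0 hgn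
  -- positivity of the chain functions
  have hfpos : ∀ k, 1 ≤ k → k ≤ n → 0 < f k := fun k h1 h2 => by
    rw [hfk k h1 h2]; exact hFpos _ (by omega) (by omega)
  have hgpos : ∀ k, 1 ≤ k → k ≤ n → 0 < g k := fun k h1 h2 => by
    rw [hgk k h1 h2]; exact hGpos _ (by omega) (by omega)
  -- Sturm ⇒ MLR
  intro b b' hb hbb' hb'
  have key := bd_mlr_pairs (n := n) (up := up) (lo := lo) (b := bb) (V := V) (π := π)
    (ψ := f) (φ := g) (s := -Δ) (t := -Δ') (Es := E) (Et := E')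
    hup_pos hπ_pos hbal hVmono (by linarith) hfpos hgpos hf0 hg0 hfn hgn hfeq hgeq
    (b - aₗ + 1) (b' - aₗ + 1) (by omega) (by omega) (by omega)
  rw [hfk _ (by omega) (by omega), hgk _ (by omega) (by omega), hfk _ (by omega) (by omega),
    hgk _ (by omega) (by omega), show aₗ + (b - aₗ + 1 - 1) = b by omega,
    show aₗ + (b' - aₗ + 1 - 1) = b' by omega] at key
  exact key

end Summit.HubbardSuperconductivity.HubbardSuperconductivity.Theorems.AnisotropyChord
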